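import Summits.Ventures.Crystal3D.TopCut.TammesCertComp
import Literature.Geometry.DiscreteGeometry.KissingCertDefs
import Literature.Geometry.DiscreteGeometry.ThreePointKernelDimThree
import Literature.Geometry.DiscreteGeometry.LegendreThreePSD
import HarnessLib

/-!
# Soundness of the `S²` certificate checker (`TammesCertComp`) — part 1: semantics of the reflective tables

Evaluation lemmas for the `n = 3` reflective constructions of `TammesCertComp` (`chebThPoly`, `Q3Poly`,
`baseTab3`, `symTab3`, `FwPoly3`/`FbPoly3`/`FPoly3`, `APoly3`, `ptX3`) and the two positivity statements the
Bachoc–Vallentin bound needs: `BachocVallentin.tripleSum C (Fval3 bs) ≥ 0` (three-point part, from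
`BachocVallentin.tripleSum_sym6_weight_nonneg3`) and `BachocVallentin.pairSum C (Aval3 d as) ≥ 0` (two-point Legendre part, from
`sum_sum_legendreI_nonneg`), for finite sets of unit vectors of `ℝ³`.

## References
* C. Bachoc, F. Vallentin, J. Amer. Math. Soc. 21 (2008), Theorem 3.2 (n = 3), Corollary 3.5, Theorem 4.2. [`BachocVallentin2007`]
-/

noncomputable section

open scoped RealInnerProductSpace

namespace Summit.Ventures.Crystal3D.TopCut

open Literature.Geometry.DiscreteGeometry Literature.Geometry.DiscreteGeometry.PolyCert Literature.Geometry.DiscreteGeometry.PolyCert.SPoly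

open Literature.Geometry.DiscreteGeometry Literature.Geometry.DiscreteGeometry.PolyCert Literature.Geometry.DiscreteGeometry.PolyCert.SPoly Literature.Geometry.DiscreteGeometry.BachocVallentin Literature.Analysis.SpecialFunctions


namespace PolyCert.SPoly

/-- `eval` of `chebThPoly`: the first-kind homogeneous Chebyshev kernel `chebHom k (2h) w`. [folklore] -/
theorem eval_chebThPoly (k : ℕ) (Hp Dp : SPoly) (u v t : ℝ) :
    eval (chebThPoly k Hp Dp) u v t = chebHom k (2 * eval Hp u v t) (eval Dp u v t) := by
  induction k using Nat.twoStepInduction with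
  | zero => simp [chebThPoly, chebHom]
  | one => simp [chebThPoly, chebHom]
  | more k ih0 ih1 =>
    rw [chebThPoly, eval_normalize, eval_append, eval_mulN, eval_neg, eval_mulN, ih0, ih1, eval_smul]
    simp only [chebHom]
    push_cast
    ring

/-- `eval (Q3Poly k) = Q3 k` (Bachoc–Vallentin's `S²` three-point kernel). [cite: BachocVallentin2007, Theorem 3.2 (n = 3)] -/
theorem eval_Q3Poly (k : ℕ) (u v t : ℝ) : eval (Q3Poly k) u v t = Q3 k u v t := by
  rw [Q3Poly, eval_normalize, eval_chebThPoly, Q3]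
  simp only [eval_append, eval_neg, eval_mul, eval_T, eval_U, eval_V, eval_C]
  push_cast
  ring_nf

/-- `eval` of `baseTab3`. [folklore] -/
theorem eval_baseTab3 (k a b : ℕ) (u v t : ℝ) :
    eval (baseTab3 k a b) u v t = u ^ a * v ^ b * Q3 k u v t := by
  rw [baseTab3, eval_normalize, eval_mulN, eval_Q3Poly]; simp [eval, Mono.eval]

/-- `eval` of `symTab3`. [folklore] -/
theorem eval_symTab3 (k a b : ℕ) (u v t : ℝ) :
    eval (symTab3 k a b) u v t = sym6 (fun u v t => u ^ a * v ^ b * Q3 k u v t) u v t := by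
  simp only [symTab3, eval_normalize, eval_append, eval_permBAC, eval_permACB, eval_permCBA,
    eval_permCAB, eval_permBCA, eval_baseTab3, sym6]

end PolyCert.SPoly

/-! ### The three-point part on `S²` -/

/-- The `Y`-form with a weight function, `S²` kernel. [cite: BachocVallentin2007, Theorem 3.2] -/
def YP3 (k : ℕ) (φ : ℝ → ℝ) (u v t : ℝ) : ℝ := φ u * φ v * Q3 k u v t

/-- `F_int(u,v,t) = Σ_blocks Σ_w sym6 (YP3 k φ_w) (u,v,t)` (integer units). [folklore] -/
def Fval3 (bs : List FBlk) (u v t : ℝ) : ℝ :=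
  (bs.map fun b => (b.ws.map fun w => sym6 (YP3 b.k (phiW w)) u v t).sum).sum

/-- `tripleSum` of a list-indexed sum of functions (ℝ³). [folklore] -/
theorem tripleSum_listSum3 {α : Type*} (C : Finset (EuclideanSpace ℝ (Fin 3))) (l : List α) (f : α → ℝ → ℝ → ℝ → ℝ) :
    BachocVallentin.tripleSum C (fun u v t => (l.map fun a => f a u v t).sum) = (l.map fun a => BachocVallentin.tripleSum C (f a)).sum := by
  induction l with
  | nil => simp [BachocVallentin.tripleSum]
  | cons a l ih =>
    simp only [List.map_cons, List.sum_cons]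
    rw [← ih]
    simp only [BachocVallentin.tripleSum, Finset.sum_add_distrib]

/-- **Positivity of the three-point part on `S²`**: `BachocVallentin.tripleSum C F_int ≥ 0`. [cite: BachocVallentin2007, Corollary 3.5] -/
theorem tripleSum_Fval3_nonneg (bs : List FBlk) (C : Finset (EuclideanSpace ℝ (Fin 3)))
    (hC : ∀ x ∈ C, ‖x‖ = 1) : 0 ≤ BachocVallentin.tripleSum C (Fval3 bs) := by
  unfold Fval3
  rw [tripleSum_listSum3]
  refine List.sum_nonneg ?_
  intro x hx
  rw [List.mem_map] at hx
  obtain ⟨b, _, rfl⟩ := hx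
  rw [tripleSum_listSum3]
  refine List.sum_nonneg ?_
  intro y hy
  rw [List.mem_map] at hy
  obtain ⟨w, _, rfl⟩ := hy
  exact tripleSum_sym6_weight_nonneg3 b.k (phiW w) C hC

/-- `F_int` is symmetric in its first two arguments. [folklore] -/
theorem Fval3_swap12 (bs : List FBlk) (u v t : ℝ) : Fval3 bs u v t = Fval3 bs v u t := by
  unfold Fval3
  congr 1; refine List.map_congr_left fun b _ => ?_
  congr 1; refine List.map_congr_left fun w _ => ?_
  exact sym6_swap12 _ u v t

/-- `F_int` is symmetric in its last two arguments. [folklore] -/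
theorem Fval3_swap23 (bs : List FBlk) (u v t : ℝ) : Fval3 bs u v t = Fval3 bs u t v := by
  unfold Fval3
  congr 1; refine List.map_congr_left fun b _ => ?_
  congr 1; refine List.map_congr_left fun w _ => ?_
  exact sym6_swap23 _ u v t

/-- Expansion of one block: `sym6 (YP3 k φ_w) = Σ_{a,b} w_a w_b sym6 (u^a v^b Q3 k)`. [folklore] -/
theorem sym6_YP3_phiW (k : ℕ) (w : List ℤ) (u v t : ℝ) :
    sym6 (YP3 k (phiW w)) u v t = ∑ a ∈ Finset.range w.length, ∑ b ∈ Finset.range w.length,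
      ((w.getD a 0 * w.getD b 0 : ℤ) : ℝ) * sym6 (fun u v t => u ^ a * v ^ b * Q3 k u v t) u v t := by
  have key : ∀ x y q : ℝ, phiW w x * phiW w y * q =
      ∑ a ∈ Finset.range w.length, ∑ b ∈ Finset.range w.length,
        ((w.getD a 0 * w.getD b 0 : ℤ) : ℝ) * (x ^ a * y ^ b * q) := by
    intro x y q
    unfold phiW
    rw [Finset.sum_mul_sum, Finset.sum_mul]
    refine Finset.sum_congr rfl fun a _ => ?_
    rw [Finset.sum_mul]
    refine Finset.sum_congr rfl fun b _ => ?_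
    push_cast; ring
  simp only [sym6, YP3, key, ← Finset.sum_add_distrib]
  refine Finset.sum_congr rfl fun a _ => Finset.sum_congr rfl fun b _ => ?_
  ring

namespace PolyCert.SPoly

/-- `eval (FwPoly3 k w) = sym6 (YP3 k φ_w)`. [folklore] -/
theorem eval_FwPoly3 (k : ℕ) (w : List ℤ) (u v t : ℝ) :
    eval (FwPoly3 k w) u v t = sym6 (YP3 k (phiW w)) u v t := by
  rw [FwPoly3, eval_mergeAll, List.map_map, sym6_YP3_phiW, ← list_sum_map_range]
  refine congrArg List.sum (List.map_congr_left fun a _ => ?_)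
  simp only [Function.comp_apply]
  rw [eval_mergeAll, List.map_map, ← list_sum_map_range]
  refine congrArg List.sum (List.map_congr_left fun b' _ => ?_)
  simp only [Function.comp_apply]
  rw [eval_smul, eval_symTab3]

/-- `eval` of one block. [folklore] -/
theorem eval_FbPoly3 (b : FBlk) (u v t : ℝ) :
    eval (FbPoly3 b) u v t = (b.ws.map fun w => sym6 (YP3 b.k (phiW w)) u v t).sum := by
  rw [FbPoly3, eval_mergeAll, List.map_map]
  refine congrArg List.sum (List.map_congr_left fun w _ => ?_)
  simp only [Function.comp_apply]
  rw [eval_FwPoly3]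

/-- `eval (FPoly3 bs) = Fval3 bs`. [folklore] -/
theorem eval_FPoly3 (bs : List FBlk) (u v t : ℝ) : eval (FPoly3 bs) u v t = Fval3 bs u v t := by
  rw [FPoly3, eval_mergeAll, List.map_map, Fval3]
  refine congrArg List.sum (List.map_congr_left fun b _ => ?_)
  simp only [Function.comp_apply]
  rw [eval_FbPoly3]

end PolyCert.SPoly

/-! ### The two-point part on `S²` (Legendre) -/

/-- `Ã(u) = Σ_{i<|as|} as_i · 2^{d-(i+1)} · legendreI (i+1) u 1` (integer units; `= 2^{S+d}·Σ_k a_k P_k(u)` when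
`a_k = as_{k-1}/2^S`, since `legendreI k u 1 = 2^k P_k(u)`). [folklore] -/
def Aval3 (d : ℕ) (as : List ℤ) (u : ℝ) : ℝ :=
  ∑ i ∈ Finset.range as.length, (as.getD i 0 : ℝ) * (2 : ℝ) ^ (d - (i + 1)) * legendreI (i + 1) u 1

/-- **Positivity of the two-point part on `S²`**: `BachocVallentin.pairSum C Ã ≥ 0` for nonnegative coefficients. [cite: BachocVallentin2007, §2 (pos 1)] -/
theorem pairSum_Aval3_nonneg (d : ℕ) (as : List ℤ) (hpos : ∀ k, 0 ≤ as.getD k 0)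
    (C : Finset (EuclideanSpace ℝ (Fin 3))) (hC : ∀ x ∈ C, ‖x‖ = 1) : 0 ≤ BachocVallentin.pairSum C (Aval3 d as) := by
  unfold BachocVallentin.pairSum Aval3
  have e : ∀ x ∈ C, (∑ y ∈ C, ∑ i ∈ Finset.range as.length,
      (as.getD i 0 : ℝ) * (2 : ℝ) ^ (d - (i + 1)) * legendreI (i + 1) (inner ℝ x y) 1) =
      ∑ i ∈ Finset.range as.length, ∑ y ∈ C,
        (as.getD i 0 : ℝ) * (2 : ℝ) ^ (d - (i + 1)) * legendreI (i + 1) (inner ℝ x y) 1 :=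
    fun x _ => Finset.sum_comm
  rw [Finset.sum_congr rfl e, Finset.sum_comm]
  refine Finset.sum_nonneg fun i _ => ?_
  have h := sum_sum_legendreI_nonneg (i + 1) C (fun _ => (1 : ℝ)) (fun x => x)
  have h' : 0 ≤ ∑ x ∈ C, ∑ y ∈ C, legendreI (i + 1) (inner ℝ x y) 1 := by
    have e1 : (∑ x ∈ C, ∑ y ∈ C, legendreI (i + 1) (inner ℝ x y) 1) =
        ∑ x ∈ C, ∑ y ∈ C, (1 : ℝ) * 1 * legendreI (i + 1) (inner ℝ x y) (‖x‖ ^ 2 * ‖y‖ ^ 2) := by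
      refine Finset.sum_congr rfl fun x hx => Finset.sum_congr rfl fun y hy => ?_
      rw [hC x hx, hC y hy]; ring
    rw [e1]; exact h
  have e2 : (∑ x ∈ C, ∑ y ∈ C, (as.getD i 0 : ℝ) * (2 : ℝ) ^ (d - (i + 1)) * legendreI (i + 1) (inner ℝ x y) 1) =
      ((as.getD i 0 : ℝ) * (2 : ℝ) ^ (d - (i + 1))) * ∑ x ∈ C, ∑ y ∈ C, legendreI (i + 1) (inner ℝ x y) 1 := by
    rw [Finset.mul_sum]; refine Finset.sum_congr rfl fun x _ => ?_; rw [Finset.mul_sum]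
  rw [e2]
  exact mul_nonneg (mul_nonneg (by exact_mod_cast hpos i) (by positivity)) h'

namespace PolyCert.SPoly

/-- `eval (APoly3 d as) u v t = Aval3 d as u`. [folklore] -/
theorem eval_APoly3 (d : ℕ) (as : List ℤ) (u v t : ℝ) : eval (APoly3 d as) u v t = Aval3 d as u := by
  unfold APoly3 Aval3
  rw [eval_mergeAll, List.map_map, ← list_sum_map_range]
  refine congrArg List.sum (List.map_congr_left fun i _ => ?_)
  simp only [Function.comp_apply]
  rw [eval_smul, eval_legendreIPoly]
  simp only [eval_U, eval_C, Int.cast_mul, Int.cast_pow, Int.cast_ofNat]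
  ring

/-- `eval` of the box multiplier `(p - qX)(1 + X)`. [folklore] -/
theorem eval_ptX3 (p q : ℤ) (X : SPoly) (u v t : ℝ) :
    eval (ptX3 p q X) u v t = ((p : ℝ) - q * eval X u v t) * (1 + eval X u v t) := by
  rw [ptX3, eval_normalize, eval_mul, eval_append, eval_append, eval_neg, eval_smul, eval_C, eval_C]
  push_cast
  ring

end PolyCert.SPoly


/-! ## Part 2: soundness of the checks and the bound `|C| ≤ 12` -/

namespace PolyCert.SPoly

/-- Semantic validity of an `S²` `F` expansion: `FP = F_int` on the unit box. [folklore] -/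
def FexpValid3 (F : List FBlk) (FP : SPoly) : Prop :=
  ∀ u v t : ℝ, |u| ≤ 1 → |v| ≤ 1 → |t| ≤ 1 → eval FP u v t = Fval3 F u v t

/-- `FexpOK3` implies validity. [folklore] -/
theorem fexpValid3_of_ok (F : List FBlk) (FP : SPoly) (h : FexpOK3 F FP = true) : FexpValid3 F FP := by
  intro u v t hu hv ht
  rw [← eval_FPoly3]; exact (eval_eq_of_residual0 _ _ h u v t hu hv ht).symm

/-- `Fval3` is additive in the block list. [folklore] -/
theorem Fval3_append (l₁ l₂ : List FBlk) (u v t : ℝ) :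
    Fval3 (l₁ ++ l₂) u v t = Fval3 l₁ u v t + Fval3 l₂ u v t := by
  simp [Fval3, List.map_append, List.sum_append]

/-- Soundness of a block-chunk check on `S²`. [folklore] -/
theorem eval_of_FchunkOK3 (bs : List FBlk) (Dprev Dnext : SPoly) (h : FchunkOK3 bs Dprev Dnext = true)
    (u v t : ℝ) (hu : |u| ≤ 1) (hv : |v| ≤ 1) (ht : |t| ≤ 1) :
    eval Dnext u v t = eval Dprev u v t + Fval3 bs u v t := by
  have h0 := abs_eval_le_of_residualBound _ _ h hu hv ht
  rw [eval_append, eval_append, eval_neg, eval_FPoly3] at h0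
  have h1 : |Dprev.eval u v t + Fval3 bs u v t + -Dnext.eval u v t| ≤ 0 := by simpa using h0
  have h2 := abs_nonpos_iff.1 h1
  linarith

/-- Validity of an `S²` `F` expansion from three block chunks. [folklore] -/
theorem fexpValid3_of_chunks (F : List FBlk) (FP D1 D2 : SPoly) (n1 n2 : ℕ)
    (h1 : FchunkOK3 (F.take n1) [] D1 = true) (h2 : FchunkOK3 ((F.drop n1).take n2) D1 D2 = true)
    (h3 : FchunkOK3 ((F.drop n1).drop n2) D2 FP = true) : FexpValid3 F FP := by
  intro u v t hu hv ht
  have e1 := eval_of_FchunkOK3 _ _ _ h1 u v t hu hv ht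
  have e2 := eval_of_FchunkOK3 _ _ _ h2 u v t hu hv ht
  have e3 := eval_of_FchunkOK3 _ _ _ h3 u v t hu hv ht
  have hsplit : F = F.take n1 ++ ((F.drop n1).take n2 ++ (F.drop n1).drop n2) := by
    rw [List.take_append_drop, List.take_append_drop]
  rw [e3, e2, e1]
  conv_rhs => rw [hsplit]
  rw [Fval3_append, Fval3_append]
  simp only [eval_nil, zero_add, List.drop_drop]
  ring

/-- A polynomial (given by its term list) is nonnegative on the unit box. [folklore] -/
def BoxNonneg (R : SPoly) : Prop :=
  ∀ u v t : ℝ, |u| ≤ 1 → |v| ≤ 1 → |t| ≤ 1 → 0 ≤ eval R u v t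

/-- A Gram expansion validated in one kernel computation (`quadExpOK`) is nonnegative on the box. [folklore] -/
theorem boxNonneg_of_quadExpOK (g : GramBlk) (R : SPoly) (h : quadExpOK g R = true) : BoxNonneg R :=
  fun u v t hu hv ht => eval_R_nonneg_of_ok g R h u v t hu hv ht

/-- A Gram expansion validated by row chunks (`QuadOK3`) is nonnegative on the box. [folklore] -/
theorem boxNonneg_of_quadOK3 (g : GramBlk) (R : SPoly) (h : QuadOK3 g R) : BoxNonneg R :=
  fun u v t hu hv ht => eval_R_nonneg_of_quadOK3 g R h u v t hu hv ht

/-- All expansions of an `S²` certificate are valid: `FP = F_int` on the box and every SOS expansion is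
nonnegative on the box (each established by `FexpOK3`/`FchunkOK3` resp. `quadExpOK`/`chunkOK` kernel checks). [folklore] -/
structure PolysOK3 (c : Cert3) (P : CertPolys) : Prop where
  /-- `F` expansion valid (on the box) -/
  hF : FexpValid3 c.F P.FP
  /-- `r ≥ 0` on the box -/
  hr : BoxNonneg P.Rr
  /-- `r_u ≥ 0` on the box -/
  hu : BoxNonneg P.Ru
  /-- `r_v ≥ 0` on the box -/
  hv : BoxNonneg P.Rv
  /-- `r_t ≥ 0` on the box -/
  ht : BoxNonneg P.Rt
  /-- `r_4 ≥ 0` on the box -/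
  h4 : BoxNonneg P.R4
  /-- `q ≥ 0` on the box -/
  hq : BoxNonneg P.Qq
  /-- `q_1 ≥ 0` on the box -/
  hq1 : BoxNonneg P.Qq1

end PolyCert.SPoly

end Summit.Ventures.Crystal3D.TopCut

end
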